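import Summits.PneNP.PneNP.Theorems.SymmetryBudgetNoHiddenOrderPerPathCGAdm

/-!
# The realised valuation with an ARBITRARY comparison order (`NoHiddenOrder`, (R2c) support)

Route `PneNP/SymmetryBudget`, `NoHiddenOrder` (stmt-PneNP-14781). `cgValuation` (`…PerPathCGProcess`) sorts the part values and picks among the
candidate values with the lexicographic order OF `Enc = List (Lex (ℕ × List Bool))`. A circuit compares fixed-width bit renderings of values with
ITS OWN lexicographic comparator; reproducing the `Enc` instance order bit-exactly is pointless work. Soundness and completeness of the certified
scheme do not depend on the order at all, so here the order is a PARAMETER: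

* `exists_assembleAND_eq_encOf_of_perm` — (P1) in sort-free form: gluing realised copies of the switching components in ANY order realises the block;
* `cgValuationBy G r` for any decidable relation `r` on `Enc`: paste = `assembleAND` of the part values sorted by `insertionSort r`, pick = the head
  of the `r`-sorted candidate list (`cgPasteBy`, `cgPickBy`); it is a `CertifiedLabels.Valuation (cgProcess G) Enc` with the same `Good` (realised
  copies), so `cg_val_sound_by` and — through `cg_root_good_dec_admB` — `cg_root_value_ptrDec_admB_by` / `…_refineIn_by` hold verbatim:
  **decoded by pointer consensus, with admissibility `AdmB` and ANY comparison order, the scheme outputs a copy of the start block at the root**;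
* `cgPickBy_eq_some_iff` — for a total, transitive, antisymmetric `r` (e.g. the pull-back of the circuit's bit order along an injective rendering)
  the pick is THE `r`-least candidate, which is what a lex-min gadget computes.
-/

-- `Summit.PneNP.PneNP.…` duplicates `PneNP` BY DESIGN (single-problem summit, D-0017 layout).
set_option linter.dupNamespace false

namespace Summit.PneNP.PneNP.Theorems

open Finset

namespace BranchSum

variable {V : Type*} [DecidableEq V] (G : SimpleGraph V) [DecidableRel G.Adj]

/-! ### (P1) without sorting -/

variable {G} in
/-- **(P1), sort-free form.** Gluing realised copies of the switching components of `(A, col)` — each component enumerated exactly once, in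
ANY order — realises `(A, col)`. (`exists_assembleAND_sort_eq_encOf` of `…PerPathCGProcess` is the case of the sorted list.) -/
theorem exists_assembleAND_eq_encOf_of_perm {A : Finset V} {col : V → ℕ} (Ls : List (List V)) (hnd : ∀ l ∈ Ls, l.Nodup)
    (hparts : List.Perm (Ls.map List.toFinset) (A.image fun u => swReach G A col u).toList) (Es : List Enc)
    (hEs : List.Perm Es (Ls.map (encOf G col))) :
    ∃ l : List V, l.Nodup ∧ l.toFinset = A ∧
      assembleAND (fun k k' => decide (SwCompC G A col k k')) Es = encOf G col l := by
  -- the list is `L.map encOf` for a permutation `L` of `Ls`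
  obtain ⟨L, hL, hLperm⟩ : Relation.Comp (· = List.map (encOf G col) ·) List.Perm Es Ls := by
    rw [List.eq_map_comp_perm]
    exact hEs
  have hLfin : List.Perm (L.map List.toFinset) (A.image fun u => swReach G A col u).toList :=
    (hLperm.map List.toFinset).trans hparts
  have hmemK : ∀ l ∈ L, ∃ u ∈ A, swReach G A col u = l.toFinset := fun l hl => by
    have : l.toFinset ∈ (A.image fun u => swReach G A col u).toList := hLfin.subset (List.mem_map.2 ⟨l, hl, rfl⟩)
    exact mem_image.1 (mem_toList.1 this)
  -- two members with different vertex sets are different components: disjoint, uniform cross data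
  have hdist : ∀ l₁ ∈ L, ∀ l₂ ∈ L, l₁.toFinset ≠ l₂.toFinset → ∀ u ∈ l₁, ∀ w ∈ l₂,
      u ≠ w ∧ ¬ (swGraph G A col).Adj u w := by
    intro l₁ hl₁ l₂ hl₂ hne u hu w hw
    obtain ⟨a, ha, hKa⟩ := hmemK l₁ hl₁
    obtain ⟨b, hb, hKb⟩ := hmemK l₂ hl₂
    have hu' : u ∈ swReach G A col a := hKa ▸ List.mem_toFinset.2 hu
    have hw' : w ∈ swReach G A col b := hKb ▸ List.mem_toFinset.2 hw
    have hKu : swReach G A col u = swReach G A col a := swReach_eq_of_mem col ha hu'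
    have hKw : swReach G A col w = swReach G A col b := swReach_eq_of_mem col hb hw'
    refine ⟨?_, fun hadj => ?_⟩
    · rintro rfl; exact hne (hKa.symm.trans ((hKu.symm.trans hKw).trans hKb))
    · have hw'' : w ∈ swReach G A col a := swReach_closed col a hu' (swReach_subset A col b hw') hadj
      exact hne (hKa.symm.trans (((swReach_eq_of_mem col ha hw'').symm.trans hKw).trans hKb))
  have hadj_iff : ∀ l₁ ∈ L, ∀ l₂ ∈ L, l₁.toFinset ≠ l₂.toFinset → ∀ u ∈ l₁, ∀ w ∈ l₂,
      (G.Adj u w ↔ SwComp G A col u w) := by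
    intro l₁ hl₁ l₂ hl₂ hne u hu w hw
    obtain ⟨hne', hnadj⟩ := hdist l₁ hl₁ l₂ hl₂ hne u hu w hw
    rw [swGraph_adj] at hnadj
    by_contra h
    exact hnadj ⟨hne', by tauto⟩
  have hpne : L.Pairwise fun l₁ l₂ => l₁.toFinset ≠ l₂.toFinset :=
    List.pairwise_map.1 (hLfin.nodup_iff.2 (nodup_toList _))
  have hpw : L.Pairwise fun l₁ l₂ =>
      (∀ u ∈ l₁, ∀ w ∈ l₂, decide (G.Adj u w) = decide (SwCompC G A col (col u) (col w)) ∧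
        decide (G.Adj w u) = decide (SwCompC G A col (col w) (col u))) ∧ List.Disjoint l₁ l₂ := by
    refine hpne.imp_of_mem fun {l₁ l₂} h₁ h₂ hne => ⟨fun u hu w hw => ⟨?_, ?_⟩, fun u hu hu' => ?_⟩
    · exact decide_eq_decide.2 (hadj_iff l₁ h₁ l₂ h₂ hne u hu w hw)
    · exact decide_eq_decide.2 (hadj_iff l₂ h₂ l₁ h₁ hne.symm w hw u hu)
    · exact (hdist l₁ h₁ l₂ h₂ hne u hu u hu').1 rfl
  refine ⟨L.flatten, ?_, ?_, ?_⟩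
  · rw [List.nodup_flatten]
    exact ⟨fun l hl => hnd l (hLperm.subset hl), hpw.imp fun h => h.2⟩
  · ext u
    rw [List.mem_toFinset, List.mem_flatten]
    constructor
    · rintro ⟨l, hl, hul⟩
      obtain ⟨a, -, hKa⟩ := hmemK l hl
      exact swReach_subset A col a (hKa ▸ List.mem_toFinset.2 hul)
    · intro hu
      have hK : swReach G A col u ∈ L.map List.toFinset :=
        hLfin.symm.subset (mem_toList.2 (mem_image_of_mem _ hu))
      obtain ⟨l, hl, hlK⟩ := List.mem_map.1 hK
      exact ⟨l, hl, List.mem_toFinset.1 (hlK ▸ self_mem_swReach col hu)⟩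
  · rw [hL]
    exact assembleAND_map_encOf _ col L (hpw.imp fun h => h.1)


/-! ### The valuation with comparison order `r` -/

/-- Lists over a finset read through `attach`, as multisets. -/
private theorem coe_toList_attach_map'' {α β : Type*} (s : Finset α) (g : α → β) :
    ((s.attach.toList.map fun x => g x.1) : Multiset β) = s.val.map g := by
  rw [← Multiset.map_coe, coe_toList]
  have h : (s.val.attach.map Subtype.val).map g = s.val.map g := congrArg (Multiset.map g) (Multiset.attach_map_val s.val)
  rw [Multiset.map_map] at h
  exact h

variable (r : Enc → Enc → Prop) [DecidableRel r]

/-- PASTING with order `r`: `assembleAND` of the `r`-sorted part values with the colour-level switching data. -/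
noncomputable def cgPasteBy (I : CGInst V) (f : CGInst V → Enc) : Enc :=
  assembleAND (fun k k' => decide (SwCompC G I.1.1 I.1.2 k k')) (((cgParts G I).toList.map f).insertionSort r)

/-- CHOICE with order `r`: the head of the `r`-sorted list of the offered values. -/
noncomputable def cgPickBy (S : Finset Enc) : Option Enc := (S.toList.insertionSort r).head?

variable {G r}

/-- **(P1)** for `cgPasteBy`: good values of all parts paste to a good value, whatever the order. -/
theorem cgGood_pasteBy (I : CGInst V) (ps : Finset (CGInst V)) (f : CGInst V → Enc) (hs : cgStep G I = .andNode ps)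
    (hf : ∀ J ∈ ps, CGGood G J (f J)) : CGGood G I (cgPasteBy G r I f) := by
  obtain ⟨-, rfl⟩ := cgStep_eq_andNode_iff.1 hs
  -- choose the realising enumerations of the parts
  have hch : ∀ J : {J // J ∈ cgParts G I}, ∃ l : List V, l.Nodup ∧ l.toFinset = J.1.1.1 ∧ f J.1 = encOf G I.1.2 l := by
    rintro ⟨J, hJ⟩
    obtain ⟨l, hl, hlJ, hE⟩ := hf J hJ
    exact ⟨l, hl, hlJ, (mem_cgParts_iff.1 hJ).1 ▸ hE⟩
  choose lf hlf using hch
  refine exists_assembleAND_eq_encOf_of_perm ((cgParts G I).attach.toList.map lf) (fun l hl => ?_) ?_ _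
    ((List.perm_insertionSort r _).trans ?_)
  · obtain ⟨J, -, rfl⟩ := List.mem_map.1 hl
    exact (hlf J).1
  · -- the parts' vertex sets are the components, each once
    rw [← Multiset.coe_eq_coe, List.map_map, coe_toList]
    have h1 := coe_toList_attach_map'' (cgParts G I) fun J => J.1.1
    have h2 : ((cgParts G I).attach.toList.map (List.toFinset ∘ lf) : Multiset (Finset V)) =
        ((cgParts G I).attach.toList.map fun J => J.1.1.1 : Multiset (Finset V)) :=
      Multiset.coe_eq_coe.2 (List.Perm.of_eq (List.map_congr_left fun J _ => (hlf J).2.1))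
    rw [h2, h1]
    unfold cgParts
    rw [map_val, Multiset.map_map]
    exact Multiset.attach_map_val _
  · -- the given values are the copies, up to the order of `toList`
    rw [← Multiset.coe_eq_coe, List.map_map, ← Multiset.map_coe, coe_toList]
    have h2 : ((cgParts G I).attach.toList.map (encOf G I.1.2 ∘ lf) : Multiset Enc) =
        ((cgParts G I).attach.toList.map fun J => f J.1 : Multiset Enc) :=
      Multiset.coe_eq_coe.2 (List.Perm.of_eq (List.map_congr_left fun J _ => (hlf J).2.2.symm))
    rw [h2, coe_toList_attach_map'']

/-- The picked value is one of the offered ones. -/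
theorem cgPickBy_mem (S : Finset Enc) (E : Enc) (h : cgPickBy r S = some E) : E ∈ S := by
  unfold cgPickBy at h
  have hE : E ∈ S.toList.insertionSort r := List.mem_of_mem_head? h
  exact mem_toList.1 ((List.perm_insertionSort r _).subset hE)

/-- Something is picked from a non-empty offer. -/
theorem cgPickBy_ne_none (S : Finset Enc) (hS : S.Nonempty) : cgPickBy r S ≠ none := by
  unfold cgPickBy
  rw [Ne, List.head?_eq_none_iff]
  intro h
  have hlen := (List.perm_insertionSort r S.toList).length_eq
  rw [h, List.length_nil] at hlen
  obtain ⟨E, hE⟩ := hS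
  have : E ∈ S.toList := mem_toList.2 hE
  rw [List.eq_nil_of_length_eq_zero hlen.symm] at this
  exact absurd this List.not_mem_nil

variable (G r)

/-- **The realised valuation with comparison order `r`**: as `cgValuation` but sorting parts and picking candidates with `r`. -/
noncomputable def cgValuationBy : CertifiedLabels.Valuation (cgProcess G) Enc where
  Good := CGGood G
  leafVal := cgLeafVal G
  paste := cgPasteBy G r
  lift := cgLift G
  pick := cgPickBy r
  good_leaf I _ := cgGood_leaf I
  good_paste I ps f hs hf := cgGood_pasteBy I ps f hs hf
  good_lift I A ch x E hs hx hE := cgGood_lift I A ch x E hs hx hE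
  pick_mem := cgPickBy_mem
  pick_ne_none := cgPickBy_ne_none

variable {G r}

/-- **Soundness with any comparison order** (`CertifiedLabels.val_sound` instantiated): whatever a label group outputs is the copy of the block it
decodes to, read along an enumeration. -/
theorem cg_val_sound_by [Fintype V] (dec : CertifiedLabels.Label V → Option (CGInst V)) (adm : CertifiedLabels.Label V → Prop) (g : ℕ)
    (L : CertifiedLabels.Label V) (E : Enc) (h : CertifiedLabels.val (cgProcess G) (cgValuationBy G r) dec adm g L = some E) :
    ∃ I : CGInst V, dec L = some I ∧ ∃ l : List V, l.Nodup ∧ l.toFinset = I.1.1 ∧ E = encOf G I.1.2 l :=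
  CertifiedLabels.val_sound (cgProcess G) (cgValuationBy G r) dec adm g L E h

/-- **Completeness with any comparison order**: decoded by pointer consensus (fuel `≥ |V|`), admissibility `AdmB (4|V| + ⌊log₂|V|⌋)`, value range
`|V|`, equitable start, the root group outputs a copy of the start block. -/
theorem cg_root_value_ptrDec_admB_by [Fintype V] {I₀ : CGInst V}
    (hI₀ : ∀ u ∈ I₀.1.1, ∀ u' ∈ I₀.1.1, I₀.1.2 u = I₀.1.2 u' → ∀ w ∈ I₀.1.1,
      ((cellOf I₀.1.1 I₀.1.2 w).filter fun y => G.Adj u y).card = ((cellOf I₀.1.1 I₀.1.2 w).filter fun y => G.Adj u' y).card)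
    {F : ℕ} (hF : Fintype.card V ≤ F) :
    ∃ E : Enc, CertifiedLabels.val (cgProcess G) (cgValuationBy G r) (ptrDec G I₀ F)
        (fun L => AdmB (4 * Fintype.card V + Nat.log 2 (Fintype.card V)) L.X L.lam) (Fintype.card V) ⟨I₀.1.1, ∅, fun _ => 0⟩ = some E ∧
      ∃ l : List V, l.Nodup ∧ l.toFinset = I₀.1.1 ∧ E = encOf G I₀.1.2 l :=
  cg_root_good_dec_admB (cgValuationBy G r) hI₀ (ptrDec G I₀ F) fun _ _ _ h => ptrDec_reach h hF

/-- The same from a block `W` with the refinement of a start colouring `λ₀`. -/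
theorem cg_root_value_ptrDec_admB_refineIn_by [Fintype V] {W : Finset V} (hW : W.Nonempty) (lam₀ : V → ℕ) {F : ℕ} (hF : Fintype.card V ≤ F) :
    ∃ E : Enc, CertifiedLabels.val (cgProcess G) (cgValuationBy G r) (ptrDec G ⟨(W, refineIn G W lam₀), hW⟩ F)
        (fun L => AdmB (4 * Fintype.card V + Nat.log 2 (Fintype.card V)) L.X L.lam) (Fintype.card V) ⟨W, ∅, fun _ => 0⟩ = some E ∧
      ∃ l : List V, l.Nodup ∧ l.toFinset = W ∧ E = encOf G (refineIn G W lam₀) l :=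
  cg_root_value_ptrDec_admB_by (I₀ := ⟨(W, refineIn G W lam₀), hW⟩) (fun _ hu _ hu' huu' _ hw => equitableIn_refineIn W lam₀ hu hu' huu' hw) hF

/-! ### For a linear comparison order the pick is the least candidate -/

omit [DecidableRel r] in
/-- The head of an `r`-chain (`List.Pairwise r`) is `r`-below every member (reflexive `r`). -/
theorem head_rel_of_pairwise {l : List Enc} (hl : l.Pairwise r) (hrefl : ∀ a, r a a) {E : Enc} (hE : l.head? = some E) :
    ∀ E' ∈ l, r E E' := by
  cases l with
  | nil => simp at hE
  | cons a l =>
    simp only [List.head?_cons, Option.some.injEq] at hE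
    subst hE
    intro E' hE'
    rcases List.mem_cons.1 hE' with rfl | h
    · exact hrefl _
    · exact List.rel_of_pairwise_cons hl h

/-- **For a total, transitive, antisymmetric order the pick is THE least offered value.** -/
theorem cgPickBy_eq_some_iff [Std.Total r] [IsTrans Enc r] [Std.Antisymm r] {S : Finset Enc} {E : Enc} :
    cgPickBy r S = some E ↔ E ∈ S ∧ ∀ E' ∈ S, r E E' := by
  have hsorted : (S.toList.insertionSort r).Pairwise r := List.pairwise_insertionSort r _
  have hperm := List.perm_insertionSort r S.toList
  have hrefl : ∀ a, r a a := fun a => (Std.Total.total a a).elim id id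
  constructor
  · intro h
    refine ⟨cgPickBy_mem S E h, fun E' hE' => ?_⟩
    exact head_rel_of_pairwise hsorted hrefl h E' (hperm.symm.subset (mem_toList.2 hE'))
  · rintro ⟨hE, hmin⟩
    obtain ⟨E₀, hE₀⟩ := Option.ne_none_iff_exists'.1 (cgPickBy_ne_none (r := r) S ⟨E, hE⟩)
    rw [hE₀, Option.some.injEq]
    have h₁ : r E₀ E := head_rel_of_pairwise hsorted hrefl hE₀ E (hperm.symm.subset (mem_toList.2 hE))
    have h₂ : r E E₀ := hmin E₀ (cgPickBy_mem S E₀ hE₀)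
    exact Std.Antisymm.antisymm E₀ E h₁ h₂

end BranchSum

end Summit.PneNP.PneNP.Theorems
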